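import Literature.NumberTheory.LFunctions.LogFreeLemmaBAbstract
import HarnessLib

/-!
# Bombieri's Lemme B, series side, abstract sequence — large slack

Topic `Literature/NumberTheory/LFunctions`, sub-namespace `LogFreeDensity`. Everything here is
PROVED (theorems only; no definitions, no named facts).

The tree's `LogFreeDensity.lemmeB_core_abstract` (`LogFreeLemmaBAbstract.lean`; Bombieri, *Le grand
crible*, §6, Lemme B, pp. 46–48, for an abstract prime-power-supported sequence `b` with
`|b_n| ≤ Λ(n)/n`) takes the output of Lemme A on the series side with a slack `1 ≤ η ≤ 4`:
`e^{−10K}(2^{−(k+1)}/r) ≤ η ‖Σ_n b_n p_k(r log n)‖`, `K = ⌊r log x/240⌋`.  For the Dedekind zeta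
function and the class group `L`-functions of a number field of degree `n_K` the slack is
`η ≍ n_K` (the coefficients are `Λ_K(n) n^{−1−iv}/n_K`), so `η ≤ 4` is what limited the tree's
log-free zero-density estimates to degree `≤ 4` (`logFreeDensity_classGroup`) and `≤ 3`
(`logFreeDensity_dedekindZeta₁_of_le_three`).  The restriction is purely numerical: the slack enters
only the two truncation inequalities `η (K+25) 4^{K+1} ≤ e^{3K}` and `8η (240K+244) 4^K ≤ e^{218K}`,
which hold for every `η ≤ K` (`K ≥ 8`).  This file records

* `mul_trunc_ineq` — `K (K+25) 4^{K+1} ≤ e^{3K}` for `K ≥ 8`;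
* `mul_boundary_ineq` — `8K (240K+244) 4^K ≤ e^{218K}` for `K ≥ 1`;
* `lemmeB_core_abstract_of_le` — **Lemme B, abstract core, slack `1 ≤ η ≤ K`**: the same conclusion
  `e^{−10}/η² · x^{−r/10}/r³ ≤ ∫_{x^{a₀}}^{x} ‖Σ_{x^{a₀} < n ≤ t, n ∈ G_z} b_n‖² dt/t` as the tree's
  lemma, the proof being the tree's verbatim except for the two inequalities above.

It is the input of Lemme B for `L₀(s, χ)` and `ζ₁_K` in EVERY degree (`ClassGroupLogFreeLemmaBAllDegrees`,
`DedekindZeta1LogFreeLemmaBAllDegrees`), hence of the log-free zero-density estimates of Weiss 1983 Thm. 4.3 /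
Thorner–Zaman 2019 Thm. 3.2 (without the Deuring–Heilbronn factor) in every degree.

## References
* [Bombieri1987GrandCrible] E. Bombieri, *Le grand crible dans la théorie analytique des nombres*, Astérisque 18
  (1987), §6 Lemme B, pp. 46–48.
* [ThornerZaman2019] J. Thorner, A. Zaman, *A unified and improved Chebotarev density theorem*, Algebra Number
  Theory 13 (2019) 1039–1068, Thm. 3.2 (arXiv:1803.02823 §3).
* [Weiss1983] A. Weiss, *The least prime ideal*, J. reine angew. Math. 338 (1983) 56–94, Thm. 4.3.
-/

noncomputable section

open Complex Finset Filter Real MeasureTheory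
open scoped LSeries.notation ArithmeticFunction.vonMangoldt Topology Nat

namespace Literature.NumberTheory.LFunctions.LogFreeDensity

variable {b : ℕ → ℂ}

/-! ### The two truncation inequalities with a factor `K` -/

/-- **(T′)** `K (K + 25) 4^{K+1} ≤ e^{3K}` for `K ≥ 8` (`4^{K+1} ≤ e^{3(K+1)/2}` and
`K(K+25) ≤ y⁴/24 ≤ e^{y}`, `y = (3K − 3)/2 ≥ 21/2`). [folklore] -/
theorem mul_trunc_ineq {K : ℕ} (hK : 8 ≤ K) :
    (K : ℝ) * ((K : ℝ) + 25) * 4 ^ (K + 1) ≤ Real.exp (3 * K) := by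
  have hK8 : (8 : ℝ) ≤ K := by exact_mod_cast hK
  -- `4^{K+1} ≤ e^{3(K+1)/2}`
  have h16 : (16 : ℝ) ^ (K + 1) ≤ Real.exp (3 * ((K : ℝ) + 1)) := by
    have := pow_le_exp_mul (c := 16) (m := 3) (by norm_num) (by norm_num) (K + 1)
    push_cast at this
    simpa using this
  have h4 : (4 : ℝ) ^ (K + 1) ≤ Real.exp (3 / 2 * ((K : ℝ) + 1)) := by
    have hsq : ((4 : ℝ) ^ (K + 1)) ^ 2 ≤ (Real.exp (3 / 2 * ((K : ℝ) + 1))) ^ 2 := by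
      rw [← pow_mul, show (K + 1) * 2 = 2 * (K + 1) by ring, pow_mul, show (4 : ℝ) ^ 2 = 16 by norm_num,
        ← Real.exp_nat_mul]
      push_cast
      rw [show (2 : ℝ) * (3 / 2 * ((K : ℝ) + 1)) = 3 * ((K : ℝ) + 1) by ring]
      exact h16
    exact le_of_pow_le_pow_left₀ (by norm_num) (Real.exp_pos _).le hsq
  -- `K (K+25) ≤ e^{(3K-3)/2}`
  set y : ℝ := 3 / 2 * (K : ℝ) - 3 / 2 with hy
  have hy21 : (21 : ℝ) / 2 ≤ y := by rw [hy]; linarith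
  have hy0 : 0 ≤ y := by linarith
  have hpoly : (K : ℝ) * ((K : ℝ) + 25) ≤ Real.exp y := by
    have hfac := Real.pow_div_factorial_le_exp y hy0 4
    have h24 : ((Nat.factorial 4 : ℕ) : ℝ) = 24 := by norm_num [Nat.factorial]
    rw [h24] at hfac
    have hKy : (K : ℝ) = (2 * y + 3) / 3 := by rw [hy]; ring
    have hy2 : (441 : ℝ) / 4 ≤ y ^ 2 := by nlinarith
    have hy4 : 441 / 4 * y ^ 2 ≤ y ^ 4 := by nlinarith [hy2]
    have hyy : 21 / 2 * y ≤ y ^ 2 := by nlinarith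
    have hmain : (2 * y + 3) / 3 * ((2 * y + 3) / 3 + 25) ≤ y ^ 4 / 24 := by
      nlinarith [hy2, hy4, hyy, hy21]
    rw [hKy]
    exact hmain.trans hfac
  have hK0 : 0 ≤ (K : ℝ) * ((K : ℝ) + 25) := by positivity
  calc (K : ℝ) * ((K : ℝ) + 25) * 4 ^ (K + 1) ≤ Real.exp y * Real.exp (3 / 2 * ((K : ℝ) + 1)) :=
        mul_le_mul hpoly h4 (by positivity) (Real.exp_pos _).le
    _ = Real.exp (3 * K) := by rw [← Real.exp_add, hy]; ring_nf

/-- **(B′)** `8K (240 K + 244) 4^K ≤ e^{218 K}` for `K ≥ 1`. [folklore] -/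
theorem mul_boundary_ineq {K : ℕ} (hK : 1 ≤ K) :
    8 * (K : ℝ) * (240 * (K : ℝ) + 244) * 4 ^ K ≤ Real.exp (218 * K) := by
  have hK1 : (1 : ℝ) ≤ K := by exact_mod_cast hK
  have h4 : (4 : ℝ) ^ K ≤ Real.exp (2 * K) := by
    have := pow_le_exp_mul (c := 4) (m := 2) (by norm_num) (by norm_num) K
    simpa using this
  have hKexp : (K : ℝ) ≤ Real.exp K := by linarith [Real.add_one_le_exp (K : ℝ)]
  have hlin : 8 * (240 * (K : ℝ) + 244) ≤ Real.exp (215 * K) := by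
    have hq := Real.quadratic_le_exp_of_nonneg (show (0:ℝ) ≤ 215 * K by positivity)
    nlinarith
  calc 8 * (K : ℝ) * (240 * (K : ℝ) + 244) * 4 ^ K = (8 * (240 * (K : ℝ) + 244)) * K * 4 ^ K := by ring
    _ ≤ Real.exp (215 * K) * Real.exp K * Real.exp (2 * K) := by
        refine mul_le_mul (mul_le_mul hlin hKexp (by positivity) (Real.exp_pos _).le) h4 (by positivity) ?_
        positivity
    _ = Real.exp (218 * K) := by rw [← Real.exp_add, ← Real.exp_add]; ring_nf

/-! ### Lemme B, abstract core, slack `η ≤ K` -/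

set_option maxHeartbeats 3200000 in
/-- **Bombieri's Lemme B, abstract core, large slack** (the tree's `lemmeB_core_abstract` with the
slack hypothesis `η ≤ 4` replaced by `η ≤ K`, `K = ⌊r log x/240⌋`): for an abstract sequence `b` with
`|b_n| ≤ Λ(n)/n`, `b_n = 0` off the prime powers, the output of Lemme A on the series side (hypothesis
`hmain`, slack `1 ≤ η ≤ K`) implies the mean-value lower bound
`e^{−10}/η² · x^{−r/10}/r³ ≤ ∫_{x^{a₀}}^{x} ‖S(t)‖² dt/t` for the sifted summatory function `S`.
The proof is the tree's verbatim except for the two truncation inequalities, which now read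
`η (K+25) 4^{K+1} ≤ K (K+25) 4^{K+1} ≤ e^{3K}` and `8η (240K+244) 4^K ≤ e^{218K}`.
[cite: Bombieri1987GrandCrible, §6 Lemme B] -/
theorem lemmeB_core_abstract_of_le (hb : ∀ n, ‖b n‖ ≤ Λ n / n) (hb0 : ∀ n, ¬ IsPrimePow n → b n = 0)
    {r L' x η : ℝ} {z k : ℕ} (hr : 0 < r) (hr0 : r ≤ 1 / (112 * Real.exp 14)) (hu : 1 ≤ r * L')
    (hx : 0 < x) (hη1 : 1 ≤ η) (hηK : η ≤ ⌊r * Real.log x / 240⌋₊)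
    (hK8 : 8 ≤ ⌊r * Real.log x / 240⌋₊)
    (hKθ' : 8 * Real.exp 14 * (r * L') ≤ ⌊r * Real.log x / 240⌋₊)
    (hk : k ∈ Finset.Icc ⌊r * Real.log x / 240⌋₊ (2 * ⌊r * Real.log x / 240⌋₊))
    (hsumW : Summable (gTermB b r k))
    (hmain : Real.exp (-(10 * ⌊r * Real.log x / 240⌋₊)) * (2⁻¹ ^ (k + 1) / r) ≤
      η * ‖∑' n, gTermB b r k n‖)
    (hz : (z : ℝ) ≤ x ^ (expoB / 2)) :
    Real.exp (-10) / η ^ 2 * x ^ (-(r / 10)) / r ^ 3 ≤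
      ∫ t in Set.Ioc (⌊x ^ expoB⌋₊ : ℝ) x, ‖summatory (coefSiftedB b x z) t‖ ^ 2 / t := by
  classical
  set θ : ℝ := Real.exp 14 with hθ
  have hθ1 : 1 ≤ θ := Real.one_le_exp (by norm_num)
  have hηpos : 0 < η := by linarith
  set u : ℝ := r * L' with hudef
  have hu1 : (1 : ℝ) ≤ u := hu
  have hr1 : r ≤ 1 := by
    have : 1 / (112 * θ) ≤ 1 := by rw [div_le_one (by positivity)]; nlinarith
    linarith
  set Lx : ℝ := Real.log x with hLx
  set K : ℕ := ⌊r * Lx / 240⌋₊ with hKdef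
  have hK8r : (8 : ℝ) ≤ K := by exact_mod_cast hK8
  have hKpos : (0 : ℝ) < K := by linarith
  have hKθ : 8 * θ * u ≤ K := hKθ'
  have hK1 : (K : ℝ) ≤ r * Lx / 240 := Nat.floor_le (by
    have : (0:ℝ) ≤ K := by positivity
    by_contra h; push Not at h
    have : (K : ℝ) = 0 := by
      have := Nat.floor_of_nonpos h.le; rw [hKdef, this]; simp
    linarith)
  have hK2 : r * Lx / 240 < K + 1 := Nat.lt_floor_add_one _
  have hK240 : 240 * (K : ℝ) ≤ r * Lx := by linarith
  have hK240' : r * Lx < 240 * (K + 1) := by linarith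
  have hLxpos : 0 < Lx := by nlinarith only [hK240, hK8r, hr, hr1]
  have hx1 : 1 < x := by
    by_contra h
    push Not at h
    have := Real.log_nonpos hx.le h
    linarith
  have hxexp : x = Real.exp Lx := by rw [hLx, Real.exp_log hx]
  rw [Finset.mem_Icc] at hk
  have hk1 : 1 ≤ k := le_trans (by omega) hk.1
  have hkK : (K : ℝ) ≤ k := by exact_mod_cast hk.1
  have hk2K : (k : ℝ) ≤ 2 * K := by exact_mod_cast hk.2
  set M₀ : ℝ := Real.exp (-(10 * K)) * 2⁻¹ ^ (k + 1) with hM₀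
  have hM₀pos : 0 < M₀ := by positivity
  set M₁ : ℝ := M₀ / η with hM₁
  have hM₁pos : 0 < M₁ := by positivity
  have hmain' : M₁ / r ≤ ‖∑' n, gTermB b r k n‖ := by
    rw [hM₁, div_div, div_le_iff₀ (by positivity)]
    calc M₀ = Real.exp (-(10 * K)) * (2⁻¹ ^ (k + 1) / r) * r := by rw [hM₀]; field_simp
      _ ≤ η * ‖∑' n, gTermB b r k n‖ * r := mul_le_mul_of_nonneg_right hmain hr.le
      _ = _ := by ring
  /- ── the cut-offs `NX = ⌊x^{a₀}⌋`, `N = ⌊x⌋` ── -/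
  set a : ℝ := expoB with ha
  have hapos : 0 < a := expoB_pos
  have haθ : a = 1 / (480 * θ) := by rw [ha, hθ]; rfl
  set N : ℕ := ⌊x⌋₊ with hN
  set NX : ℕ := ⌊x ^ a⌋₊ with hNX
  have hxa : x ^ a = Real.exp (a * Lx) := by
    rw [Real.rpow_def_of_pos hx, hLx]; ring_nf
  have haLx : 4 ≤ a * Lx := by
    -- `a Lx = Lx/(480 θ)`, `Lx ≥ 240 K/r ≥ 1920/r`, `θ r ≤ 1/112`
    rw [haθ]
    have hθpos : 0 < θ := by positivity
    have h1 : 1920 ≤ r * Lx := by nlinarith only [hK240, hK8r]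
    have h2 : r * (480 * θ) ≤ 480 / 112 := by
      have h := hr0; rw [le_div_iff₀ (by positivity)] at h; nlinarith only [h]
    rw [show 1 / (480 * θ) * Lx = Lx / (480 * θ) by ring, le_div_iff₀ (by positivity)]
    have h3 : 4 * (480 * θ) * r ≤ 1920 := by nlinarith only [h2]
    have h4 : r * (4 * (480 * θ)) ≤ r * Lx := by linarith
    exact le_of_mul_le_mul_left h4 hr
  have hxa2 : (2 : ℝ) ≤ x ^ a := by
    rw [hxa]
    have : (2 : ℝ) ≤ Real.exp 1 := by have := Real.exp_one_gt_d9; linarith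
    exact this.trans (Real.exp_le_exp.2 (by linarith))
  have hNX1 : 1 ≤ NX := Nat.le_floor (by simp; linarith)
  have hNXle : (NX : ℝ) ≤ x ^ a := Nat.floor_le (by positivity)
  have hNXgt : x ^ a < NX + 1 := Nat.lt_floor_add_one _
  have hNXhalf : x ^ a / 2 ≤ NX := by linarith
  have hNXpos : (0 : ℝ) < NX := by exact_mod_cast hNX1
  have hxa_le_sqrt : x ^ a ≤ x ^ ((1 : ℝ) / 2) :=
    Real.rpow_le_rpow_of_exponent_le hx1.le expoB_le_half
  have hsqrt_lt : x ^ ((1 : ℝ) / 2) < x := by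
    conv_rhs => rw [← Real.rpow_one x]
    exact Real.rpow_lt_rpow_of_exponent_lt hx1 (by norm_num)
  have hNXx : (NX : ℝ) < x := lt_of_le_of_lt hNXle (hxa_le_sqrt.trans_lt hsqrt_lt)
  have hNle : (N : ℝ) ≤ x := Nat.floor_le hx.le
  have hNgt : x < N + 1 := Nat.lt_floor_add_one _
  have hNXN : NX ≤ N := Nat.floor_le_floor (by
    calc x ^ a ≤ x ^ ((1:ℝ)/2) := hxa_le_sqrt
      _ ≤ x := hsqrt_lt.le)
  have hN2r : (2 : ℝ) ≤ N := by
    have : (2 : ℝ) ≤ NX := by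
      have h4 : Real.exp 4 ≤ x ^ a := by rw [hxa]; exact Real.exp_le_exp.2 haLx
      have : (4 : ℝ) ≤ Real.exp 4 := by linarith [Real.add_one_le_exp (4:ℝ)]
      linarith
    exact this.trans (by exact_mod_cast hNXN)
  have hN2 : 2 ≤ N := by exact_mod_cast hN2r
  have hNhalf : x / 2 ≤ N := by linarith
  have hlogN : Real.log N ≤ Lx := by
    rw [hLx]; exact Real.log_le_log (by positivity) hNle
  have hlogNX : Real.log NX ≤ a * Lx := by
    have := Real.log_le_log hNXpos hNXle
    rwa [hxa, Real.log_exp] at this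
  /- ── the series and its decomposition ── -/
  set g : ℕ → ℂ := gTermB b r k with hg
  have hsum : Summable g := hsumW
  set G : Finset ℕ := (Ioc NX N).filter (fun n => IsPrimePow n ∧ z < n.minFac) with hGdef
  set SP : Finset ℕ := (Ioc NX N).filter (fun n => IsPrimePow n ∧ n.minFac ≤ z) with hSPdef
  have hsplit : ∑' n, g n = ∑ n ∈ Ioc 0 NX, g n + (∑ n ∈ G, g n + ∑ n ∈ SP, g n) +
      ∑' n, g (n + (N + 1)) := by
    rw [← hsum.sum_add_tsum_nat_add (N + 1), Finset.range_eq_Ico, show Ico 0 (N + 1) = Icc 0 N from rfl,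
      Finset.Icc_eq_cons_Ioc (Nat.zero_le N), sum_cons, show g 0 = 0 from gTermB_zero hb r k, zero_add,
      ← Finset.sum_Ioc_consecutive g (Nat.zero_le NX) hNXN]
    congr 2
    -- the middle range: prime powers with all prime factors `> z`, those with one `≤ z`, and `Λ = 0`
    rw [← sum_filter_add_sum_filter_not (Ioc NX N) IsPrimePow]
    have hzero : ∑ n ∈ (Ioc NX N).filter (fun n => ¬ IsPrimePow n), g n = 0 :=
      sum_eq_zero fun n hn => gTermB_eq_zero_of_not_isPrimePow hb0 r k (mem_filter.1 hn).2
    rw [hzero, add_zero, ← sum_filter_add_sum_filter_not ((Ioc NX N).filter IsPrimePow) (fun n => z < n.minFac),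
      Finset.filter_filter, Finset.filter_filter]
    congr 1
    refine sum_congr ?_ fun _ _ => rfl
    rw [hSPdef]
    congr 1
    funext n
    simp only [not_lt]
  /- ── (T_tail) `n > x` ── -/
  set d : ℝ := 19 / 20 * r with hd
  have hd0 : 0 < d := by positivity
  have hd1 : d ≤ 1 := by rw [hd]; linarith
  have htail_term : ∀ n : ℕ, N + 1 ≤ n → ‖g n‖ ≤ Λ n * (n : ℝ) ^ (-(1 + d)) := by
    intro n hn
    have hn0 : (0 : ℝ) < n := by exact_mod_cast (lt_of_lt_of_le (Nat.succ_pos N) hn)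
    have hxn : x ≤ n := by
      have : ((N + 1 : ℕ) : ℝ) ≤ n := by exact_mod_cast hn
      push_cast at this; linarith
    refine (norm_gTermB_le hb hr.le k n).trans ?_
    -- `p_k(r log n) ≤ e^{-19 r log n / 20} = n^{-d}` since `r log n ≥ r log x ≥ 240 K ≥ 120 k`
    have hlogn : Lx ≤ Real.log n := by rw [hLx]; exact Real.log_le_log hx hxn
    have h120 : 120 * (k : ℝ) ≤ r * Real.log n := by
      have := mul_le_mul_of_nonneg_left hlogn hr.le
      linarith only [this, hk2K, hK240]
    have hpk := pk_le_exp_of_ge hk1 h120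
    have heq : Real.exp (-(19 / 20 * (r * Real.log n))) = (n : ℝ) ^ (-d) := by
      rw [Real.rpow_def_of_pos hn0, hd]; ring_nf
    rw [heq] at hpk
    have hΛ : 0 ≤ Λ n / n := div_nonneg ArithmeticFunction.vonMangoldt_nonneg hn0.le
    calc Λ n / n * pk k (r * Real.log n) ≤ Λ n / n * (n : ℝ) ^ (-d) := mul_le_mul_of_nonneg_left hpk hΛ
      _ = Λ n * (n : ℝ) ^ (-(1 + d)) := by
          rw [neg_add, Real.rpow_add hn0, Real.rpow_neg_one, div_eq_mul_inv]; ring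
  have htail_sum : Summable fun i => ‖g (i + (N + 1))‖ := (hsum.comp_injective (add_left_injective _)).norm
  have htail_bound : ∑' i, ‖g (i + (N + 1))‖ ≤ (3 * Real.log 4 / d + 2) * (N : ℝ) ^ (-d) := by
    refine Real.tsum_le_of_sum_range_le (fun i => norm_nonneg _) fun M => ?_
    rcases Nat.eq_zero_or_pos M with hM0 | hMpos
    · rw [hM0, sum_range_zero]; positivity
    calc ∑ i ∈ Finset.range M, ‖g (i + (N + 1))‖
        = ∑ n ∈ Ioc N (N + M), ‖g n‖ := by
          refine Finset.sum_nbij' (fun i => i + (N + 1)) (fun n => n - (N + 1)) ?_ ?_ ?_ ?_ ?_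
          · intro i hi; rw [Finset.mem_range] at hi; rw [Finset.mem_Ioc]; omega
          · intro n hn; rw [Finset.mem_Ioc] at hn; rw [Finset.mem_range]; omega
          · intro i _; omega
          · intro n hn; rw [Finset.mem_Ioc] at hn; omega
          · intro i _; rfl
      _ ≤ ∑ n ∈ Ioc N (N + M), Λ n * (n : ℝ) ^ (-(1 + d)) := by
          refine sum_le_sum fun n hn => htail_term n ?_
          rw [Finset.mem_Ioc] at hn; omega
      _ ≤ (3 * Real.log 4 / d + 2) * (N : ℝ) ^ (-d) :=
          sum_Ioc_vonMangoldt_mul_rpow_le hd0 hd1 hN2 (Nat.le_add_right N M)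
  have hlog4 : Real.log 4 ≤ 1.4 := by
    have h : Real.log 4 = 2 * Real.log 2 := by
      rw [show (4:ℝ) = 2 ^ 2 by norm_num, Real.log_pow]; norm_num
    rw [h]
    have := Real.log_two_lt_d9
    linarith
  have hT_tail : ‖∑' i, g (i + (N + 1))‖ ≤ 14 * Real.exp (-(13 * K)) / r := by
    refine (norm_tsum_le_tsum_norm htail_sum).trans (htail_bound.trans ?_)
    -- `(3 log 4/d + 2) ≤ 7/r`, `N^{-d} ≤ 2 x^{-d} ≤ 2 e^{-228 K} ≤ 2 e^{-13K}`
    have h1 : 3 * Real.log 4 / d + 2 ≤ 7 / r := by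
      rw [hd, div_add' _ _ _ (by positivity), div_le_div_iff₀ (by positivity) hr]
      have hl0 : 0 ≤ Real.log 4 := Real.log_nonneg (by norm_num)
      nlinarith only [hlog4, hr, hr1, hl0]
    have hN0 : (0 : ℝ) < N := by linarith
    have h2 : (N : ℝ) ^ (-d) ≤ 2 * Real.exp (-(13 * K)) := by
      -- `N ≥ x/2`, so `N^{-d} ≤ (x/2)^{-d} = 2^d x^{-d} ≤ 2 x^{-d}`
      have hx2 : (0 : ℝ) < x / 2 := by positivity
      have h21 : (N : ℝ) ^ (-d) ≤ (x / 2) ^ (-d) := by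
        rw [Real.rpow_neg hN0.le, Real.rpow_neg hx2.le]
        exact inv_anti₀ (Real.rpow_pos_of_pos hx2 d) (Real.rpow_le_rpow hx2.le hNhalf hd0.le)
      have h22 : (x / 2) ^ (-d) = 2 ^ d * x ^ (-d) := by
        rw [Real.div_rpow hx.le (by norm_num), Real.rpow_neg hx.le, Real.rpow_neg (by norm_num)]
        field_simp
      have h23 : (2 : ℝ) ^ d ≤ 2 := by
        conv_rhs => rw [← Real.rpow_one 2]
        exact Real.rpow_le_rpow_of_exponent_le (by norm_num) hd1
      have h24 : x ^ (-d) ≤ Real.exp (-(13 * K)) := by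
        rw [hxexp, ← Real.exp_mul]
        refine Real.exp_le_exp.2 ?_
        rw [hd]; nlinarith only [hK240, hKpos.le]
      have hxd : 0 ≤ x ^ (-d) := by positivity
      calc (N : ℝ) ^ (-d) ≤ (x / 2) ^ (-d) := h21
        _ = 2 ^ d * x ^ (-d) := h22
        _ ≤ 2 * Real.exp (-(13 * K)) := mul_le_mul h23 h24 hxd (by norm_num)
    have h3 : 0 ≤ 3 * Real.log 4 / d + 2 := by positivity
    calc (3 * Real.log 4 / d + 2) * (N : ℝ) ^ (-d) ≤ (7 / r) * (2 * Real.exp (-(13 * K))) :=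
          mul_le_mul h1 h2 (by positivity) (by positivity)
      _ = 14 * Real.exp (-(13 * K)) / r := by ring
  /- ── (T_small) `n ≤ NX` ── -/
  have hθpos : 0 < θ := by positivity
  have heθ : Real.exp 1 / θ = Real.exp (-13) := by
    rw [hθ, ← Real.exp_sub]; norm_num
  have hT_small : ‖∑ n ∈ Ioc 0 NX, g n‖ ≤ Real.exp (-(13 * K)) * ((K : ℝ) + 5) / r := by
    have hpk_small : ∀ n ∈ Ioc 0 NX, pk k (r * Real.log n) ≤ Real.exp (-(13 * K)) := by
      intro n hn
      rw [Finset.mem_Ioc] at hn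
      have hn0 : (0 : ℝ) < n := by exact_mod_cast hn.1
      have hlogn : Real.log n ≤ a * Lx :=
        (Real.log_le_log hn0 (by exact_mod_cast hn.2)).trans hlogNX
      have hu0 : 0 ≤ r * Real.log n := mul_nonneg hr.le (Real.log_natCast_nonneg n)
      have huk : r * Real.log n ≤ k / θ := by
        have h1 : r * Real.log n ≤ a * (r * Lx) := by
          have := mul_le_mul_of_nonneg_left hlogn hr.le; linarith only [this]
        have h2 : a * (r * Lx) ≤ (K + 1) / (2 * θ) := by
          rw [haθ, le_div_iff₀ (by positivity)]
          have : 1 / (480 * θ) * (r * Lx) * (2 * θ) = r * Lx / 240 := by field_simp; ring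
          rw [this, div_le_iff₀ (by norm_num)]; linarith
        have h3 : ((K : ℝ) + 1) / (2 * θ) ≤ k / θ := by
          rw [div_le_div_iff₀ (by positivity) hθpos]
          have : 0 ≤ θ * (2 * k - K - 1) := mul_nonneg hθpos.le (by linarith only [hkK, hK8r])
          nlinarith only [this]
        linarith only [h1, h2, h3]
      calc pk k (r * Real.log n) ≤ (Real.exp 1 / θ) ^ k := pk_le_of_le_div hk1 hθpos hu0 huk
        _ = Real.exp (-(13 * k)) := by rw [heθ, ← Real.exp_nat_mul]; ring_nf
        _ ≤ Real.exp (-(13 * K)) := Real.exp_le_exp.2 (by linarith only [hkK])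
    have hsumΛ : ∑ n ∈ Ioc 0 NX, Λ n / n ≤ ((K : ℝ) + 5) / r := by
      have h1 := sum_vonMangoldt_div_le NX
      rw [show Ioc 0 NX = Icc 1 NX from rfl]
      refine h1.trans ?_
      have h2 : a * Lx ≤ ((K : ℝ) + 1) / r := by
        rw [le_div_iff₀ hr, haθ]
        have : 1 / (480 * θ) * Lx * r = r * Lx / (480 * θ) := by ring
        rw [this, div_le_iff₀ (by positivity)]
        have : 0 ≤ ((K : ℝ) + 1) * (480 * θ - 240) := mul_nonneg (by positivity) (by linarith only [hθ1])
        nlinarith only [hK240', this]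
      have h3 : (4 : ℝ) ≤ 4 / r := by rw [le_div_iff₀ hr]; linarith only [hr1]
      have h4 : ((K : ℝ) + 1) / r + 4 / r = ((K : ℝ) + 5) / r := by ring
      linarith
    calc ‖∑ n ∈ Ioc 0 NX, g n‖ ≤ ∑ n ∈ Ioc 0 NX, ‖g n‖ := norm_sum_le _ _
      _ ≤ ∑ n ∈ Ioc 0 NX, Real.exp (-(13 * K)) * (Λ n / n) := by
          refine sum_le_sum fun n hn => (norm_gTermB_le hb hr.le k n).trans ?_
          rw [mul_comm]
          exact mul_le_mul_of_nonneg_right (hpk_small n hn)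
            (div_nonneg ArithmeticFunction.vonMangoldt_nonneg (Nat.cast_nonneg n))
      _ = Real.exp (-(13 * K)) * ∑ n ∈ Ioc 0 NX, Λ n / n := by rw [mul_sum]
      _ ≤ Real.exp (-(13 * K)) * (((K : ℝ) + 5) / r) :=
          mul_le_mul_of_nonneg_left hsumΛ (Real.exp_pos _).le
      _ = _ := by ring
  /- ── (T_sp) prime powers of primes `≤ z` ── -/
  have hT_sp : ‖∑ n ∈ SP, g n‖ ≤ 6 * Real.exp (-(13 * K)) / r := by
    have h1 : ‖∑ n ∈ SP, g n‖ ≤ ∑ n ∈ SP, Λ n / n := by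
      refine (norm_sum_le _ _).trans (sum_le_sum fun n _ => (norm_gTermB_le hb hr.le k n).trans ?_)
      have h0 : 0 ≤ Λ n / n := div_nonneg ArithmeticFunction.vonMangoldt_nonneg (Nat.cast_nonneg n)
      calc Λ n / n * pk k (r * Real.log n) ≤ Λ n / n * 1 :=
            mul_le_mul_of_nonneg_left (pk_le_one k (mul_nonneg hr.le (Real.log_natCast_nonneg n))) h0
        _ = Λ n / n := mul_one _
    have h2 := sum_vonMangoldt_div_smallPrime_le z hNX1 N
    rw [← hSPdef] at h2
    refine h1.trans (h2.trans ?_)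
    -- `2 (log 4) z / NX ≤ 6 x^{-a/2}`
    have hxa2pos : 0 < x ^ (a / 2) := by positivity
    have hsq : x ^ a = x ^ (a / 2) * x ^ (a / 2) := by rw [← Real.rpow_add hx]; ring_nf
    have h3 : 2 * (Real.log 4 * z) / NX ≤ 6 * (x ^ (a / 2))⁻¹ := by
      rw [div_le_iff₀ hNXpos]
      have hzz : Real.log 4 * z ≤ 1.4 * x ^ (a / 2) :=
        mul_le_mul hlog4 hz (Nat.cast_nonneg z) (by norm_num)
      have : 6 * (x ^ (a / 2))⁻¹ * NX ≥ 6 * (x ^ (a / 2))⁻¹ * (x ^ a / 2) :=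
        mul_le_mul_of_nonneg_left hNXhalf (by positivity)
      rw [hsq] at this
      have h4 : 6 * (x ^ (a / 2))⁻¹ * (x ^ (a / 2) * x ^ (a / 2) / 2) = 3 * x ^ (a / 2) := by
        field_simp; ring
      rw [h4] at this
      linarith only [hzz, this, hxa2pos.le]
    refine h3.trans ?_
    -- `x^{-a/2} = e^{-(a/2) Lx} ≤ e^{-L'} e^{-14K} ≤ r e^{-14K} ≤ e^{-13K}/r`
    have h5 : (x ^ (a / 2))⁻¹ = Real.exp (-(a / 2 * Lx)) := by
      rw [hxexp, ← Real.exp_mul, ← Real.exp_neg]; ring_nf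
    have h6 : L' + 14 * K ≤ a / 2 * Lx := by
      -- `(a/2) Lx ≥ (a/2)(240 K / r) = K/(4 θ r)` and `K/(8θr) ≥ L'`, `K/(8θr) ≥ 14 K`
      have hK4 : K / (4 * θ * r) ≤ a / 2 * Lx := by
        rw [div_le_iff₀ (by positivity), haθ]
        have : 1 / (480 * θ) / 2 * Lx * (4 * θ * r) = r * Lx / 240 := by field_simp; ring
        rw [this]; linarith
      have hK8a : L' ≤ K / (8 * θ * r) := by
        rw [le_div_iff₀ (by positivity)]
        calc L' * (8 * θ * r) = 8 * θ * u := by rw [hudef]; ring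
          _ ≤ K := hKθ
      have hK8b : 14 * (K : ℝ) ≤ K / (8 * θ * r) := by
        rw [le_div_iff₀ (by positivity)]
        have : 8 * θ * r ≤ 1 / 14 := by
          have := hr0
          rw [le_div_iff₀ (by positivity)] at this
          rw [le_div_iff₀ (by norm_num)]
          linarith only [this]
        have := mul_le_mul_of_nonneg_left this (show (0:ℝ) ≤ 14 * K by positivity)
        linarith only [this]
      have : (K : ℝ) / (8 * θ * r) + K / (8 * θ * r) = K / (4 * θ * r) := by field_simp; ring
      linarith
    have h7 : Real.exp (-L') ≤ r := by
      have hL'r : r⁻¹ ≤ L' := by rw [inv_le_iff_one_le_mul₀ hr]; rw [hudef] at hu1; linarith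
      have := Real.add_one_le_exp (r⁻¹)
      have hpos : 0 < Real.exp (r⁻¹) := Real.exp_pos _
      calc Real.exp (-L') ≤ Real.exp (-(r⁻¹)) := Real.exp_le_exp.2 (by linarith)
        _ = (Real.exp (r⁻¹))⁻¹ := Real.exp_neg _
        _ ≤ (r⁻¹)⁻¹ := by
            refine inv_anti₀ (by positivity) ?_; linarith
        _ = r := inv_inv r
    calc 6 * (x ^ (a / 2))⁻¹ = 6 * Real.exp (-(a / 2 * Lx)) := by rw [h5]
      _ ≤ 6 * (Real.exp (-L') * Real.exp (-(14 * K))) := by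
          rw [← Real.exp_add]
          exact mul_le_mul_of_nonneg_left (Real.exp_le_exp.2 (by linarith)) (by norm_num)
      _ ≤ 6 * (r * Real.exp (-(14 * K))) := by
          gcongr
      _ ≤ 6 * Real.exp (-(13 * K)) / r := by
          rw [le_div_iff₀ hr]
          have hr2 : r * r ≤ 1 := by nlinarith only [hr1, hr.le]
          have hexp : Real.exp (-(14 * K)) ≤ Real.exp (-(13 * K)) := Real.exp_le_exp.2 (by linarith only [hKpos])
          have hpos : 0 < Real.exp (-(14 * K)) := Real.exp_pos _
          have h1 := mul_le_mul hr2 hexp hpos.le (by norm_num)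
          nlinarith only [h1]
  /- ── the sum over `G` is at least `M₀/(2r)` ── -/
  have h2K : (2 : ℝ)⁻¹ ^ (2 * K + 1) ≤ 2⁻¹ ^ (k + 1) :=
    pow_le_pow_of_le_one (by norm_num) (by norm_num) (by omega)
  have h4pow : (4 : ℝ) ^ (K + 1) = 2 ^ (2 * K + 1) * 2 := by
    rw [pow_succ (2 : ℝ) (2 * K), pow_mul, show (2 : ℝ) ^ 2 = 4 by norm_num, pow_succ]; ring
  have hM₀low : Real.exp (-(10 * K)) / 4 ^ (K + 1) ≤ M₀ / 2 := by
    calc Real.exp (-(10 * K)) / 4 ^ (K + 1) = Real.exp (-(10 * K)) * 2⁻¹ ^ (2 * K + 1) / 2 := by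
          rw [h4pow, inv_pow]; field_simp
      _ ≤ Real.exp (-(10 * K)) * 2⁻¹ ^ (k + 1) / 2 := by gcongr
      _ = M₀ / 2 := by rw [hM₀]
  have hTbound : 14 * Real.exp (-(13 * K)) / r + Real.exp (-(13 * K)) * ((K : ℝ) + 5) / r +
      6 * Real.exp (-(13 * K)) / r ≤ M₁ / (2 * r) := by
    have heq : 14 * Real.exp (-(13 * K)) / r + Real.exp (-(13 * K)) * ((K : ℝ) + 5) / r +
        6 * Real.exp (-(13 * K)) / r = ((K : ℝ) + 25) * Real.exp (-(13 * K)) / r := by ring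
    rw [heq, show M₁ / (2 * r) = (M₁ / 2) / r by ring]
    refine div_le_div_of_nonneg_right ?_ hr.le
    have ht := mul_trunc_ineq hK8
    have hηt : η * (((K : ℝ) + 25) * 4 ^ (K + 1)) ≤ Real.exp (3 * K) := by
      calc η * (((K : ℝ) + 25) * 4 ^ (K + 1)) ≤ (K : ℝ) * (((K : ℝ) + 25) * 4 ^ (K + 1)) :=
            mul_le_mul_of_nonneg_right hηK (by positivity)
        _ = (K : ℝ) * ((K : ℝ) + 25) * 4 ^ (K + 1) := by ring
        _ ≤ Real.exp (3 * K) := ht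
    have h4K : ((K : ℝ) + 25) * Real.exp (-(13 * K)) ≤ Real.exp (-(10 * K)) / 4 ^ (K + 1) / η := by
      rw [le_div_iff₀ hηpos, le_div_iff₀ (by positivity)]
      calc ((K : ℝ) + 25) * Real.exp (-(13 * K)) * η * 4 ^ (K + 1)
          = (η * (((K : ℝ) + 25) * 4 ^ (K + 1))) * Real.exp (-(13 * K)) := by ring
        _ ≤ Real.exp (3 * K) * Real.exp (-(13 * K)) :=
            mul_le_mul_of_nonneg_right hηt (Real.exp_pos _).le
        _ = Real.exp (-(10 * K)) := by rw [← Real.exp_add]; ring_nf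
    have hM₁M₀ : Real.exp (-(10 * K)) / 4 ^ (K + 1) / η ≤ M₁ / 2 := by
      have h1 : Real.exp (-(10 * K)) / 4 ^ (K + 1) / η ≤ M₀ / 2 / η :=
        div_le_div_of_nonneg_right hM₀low hηpos.le
      have h2 : M₀ / 2 / η = M₁ / 2 := by rw [hM₁]; field_simp
      rw [← h2]; exact h1
    linarith [h4K, hM₁M₀]
  have hG_lower : M₁ / (2 * r) ≤ ‖∑ n ∈ G, g n‖ := by
    have heq : ∑ n ∈ G, g n = ∑' n, g n -
        (∑ n ∈ Ioc 0 NX, g n + ∑ n ∈ SP, g n + ∑' n, g (n + (N + 1))) := by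
      rw [hsplit]; ring
    rw [heq]
    have h1 := norm_sub_norm_le (∑' n, g n) (∑ n ∈ Ioc 0 NX, g n + ∑ n ∈ SP, g n + ∑' n, g (n + (N + 1)))
    have h2 : ‖∑ n ∈ Ioc 0 NX, g n + ∑ n ∈ SP, g n + ∑' n, g (n + (N + 1))‖ ≤
        Real.exp (-(13 * K)) * ((K : ℝ) + 5) / r + 6 * Real.exp (-(13 * K)) / r +
          14 * Real.exp (-(13 * K)) / r :=
      (norm_add₃_le).trans (add_le_add (add_le_add hT_small hT_sp) hT_tail)
    have h3 : M₁ / r - M₁ / (2 * r) = M₁ / (2 * r) := by field_simp; ring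
    linarith [hmain']
  /- ── partial summation ── -/
  set cS : ℕ → ℂ := coefSiftedB b x z with hcdef
  have hcG : ∀ i, cS i = if i ∈ G then b i else 0 := by
    intro i
    rw [hcdef, coefSiftedB, ← ha]
  have hGsub : G ⊆ Ioc NX N := Finset.filter_subset _ _
  have hc0 : ∀ i ≤ NX, cS i = 0 := by
    intro i hi
    rw [hcG, if_neg]
    intro hiG
    have := (mem_Ioc.1 (hGsub hiG)).1
    omega
  have hsumG : ∑ i ∈ Ioc NX ⌊x⌋₊, (pk k (r * Real.log i) : ℂ) * cS i = ∑ n ∈ G, g n := by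
    rw [← hN]
    have h1 : ∀ i ∈ Ioc NX N, (pk k (r * Real.log i) : ℂ) * cS i = if i ∈ G then g i else 0 := by
      intro i _
      rw [hcG]
      split_ifs with h
      · rw [hg, gTermB, mul_comm]
      · rw [mul_zero]
    rw [sum_congr rfl h1, ← sum_filter, Finset.filter_mem_eq_inter, Finset.inter_eq_right.2 hGsub]
  have habel := norm_sum_pk_mul_le cS hk1 hr.le hNX1 hNXx.le hc0
  rw [hsumG] at habel
  /- ── the boundary term is at most `M₀/(4r)` ── -/
  have hS_le : ‖summatory cS x‖ ≤ (240 * (K : ℝ) + 244) / r := by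
    have h1 : ‖summatory cS x‖ ≤ ∑ i ∈ Icc 0 N, ‖cS i‖ := norm_summatory_le cS le_rfl
    have h2 : ∑ i ∈ Icc 0 N, ‖cS i‖ ≤ ∑ i ∈ Icc 0 N, Λ i / i :=
      sum_le_sum fun i _ => by rw [hcdef]; exact norm_coefSiftedB_le hb x z i
    have h3 : ∑ i ∈ Icc 0 N, Λ i / i = ∑ i ∈ Icc 1 N, Λ i / i := by
      rw [Finset.Icc_eq_cons_Ioc (Nat.zero_le N), sum_cons]
      simp [show Ioc 0 N = Icc 1 N from rfl]
    have h4 := sum_vonMangoldt_div_le N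
    have h5 : Real.log N + Real.log 4 + 2 ≤ (240 * (K : ℝ) + 244) / r := by
      have hLxr : Lx ≤ 240 * ((K : ℝ) + 1) / r := by
        rw [le_div_iff₀ hr]; linarith
      have h4r : (4 : ℝ) ≤ 4 / r := by rw [le_div_iff₀ hr]; linarith only [hr1]
      have : 240 * ((K : ℝ) + 1) / r + 4 / r = (240 * (K : ℝ) + 244) / r := by ring
      linarith
    linarith
  have hpk_x : pk k (r * Real.log x) ≤ Real.exp (-(228 * K)) := by
    have h120 : 120 * (k : ℝ) ≤ r * Real.log x := by rw [← hLx]; linarith only [hk2K, hK240]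
    refine (pk_le_exp_of_ge hk1 h120).trans (Real.exp_le_exp.2 ?_)
    rw [← hLx]; linarith only [hK240]
  have hboundary : pk k (r * Real.log x) * ‖summatory cS x‖ ≤ M₁ / (4 * r) := by
    have h1 : pk k (r * Real.log x) * ‖summatory cS x‖ ≤
        Real.exp (-(228 * K)) * ((240 * (K : ℝ) + 244) / r) :=
      mul_le_mul hpk_x hS_le (norm_nonneg _) (Real.exp_pos _).le
    refine h1.trans ?_
    rw [show Real.exp (-(228 * K)) * ((240 * (K : ℝ) + 244) / r) =
        (Real.exp (-(228 * K)) * (240 * (K : ℝ) + 244)) / r by ring,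
      show M₁ / (4 * r) = (M₁ / 4) / r by ring]
    refine div_le_div_of_nonneg_right ?_ hr.le
    -- `4η (240K+244) e^{-228K} ≤ e^{-10K} 2^{-(2K+1)} ≤ M₀`, and `M₀/(4η) = M₁/4`
    have hb := mul_boundary_ineq (show 1 ≤ K by omega)
    have hηb : 8 * η * (240 * (K : ℝ) + 244) * 4 ^ K ≤ Real.exp (218 * K) := by
      calc 8 * η * (240 * (K : ℝ) + 244) * 4 ^ K = η * (8 * (240 * (K : ℝ) + 244) * 4 ^ K) := by ring
        _ ≤ (K : ℝ) * (8 * (240 * (K : ℝ) + 244) * 4 ^ K) :=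
            mul_le_mul_of_nonneg_right hηK (by positivity)
        _ = 8 * (K : ℝ) * (240 * (K : ℝ) + 244) * 4 ^ K := by ring
        _ ≤ Real.exp (218 * K) := hb
    have h2 : Real.exp (-(228 * K)) * (240 * (K : ℝ) + 244) ≤
        Real.exp (-(10 * K)) * 2⁻¹ ^ (2 * K + 1) / (4 * η) := by
      rw [le_div_iff₀ (by positivity)]
      have h3 : (2 : ℝ)⁻¹ ^ (2 * K + 1) = (2 * 4 ^ K)⁻¹ := by
        rw [inv_pow, pow_succ, pow_mul, show (2 : ℝ) ^ 2 = 4 by norm_num]; ring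
      rw [h3]
      rw [show Real.exp (-(10 * K)) * (2 * 4 ^ K)⁻¹ = Real.exp (-(10 * K)) / (2 * 4 ^ K) by
        rw [div_eq_mul_inv]]
      rw [le_div_iff₀ (by positivity)]
      calc Real.exp (-(228 * K)) * (240 * (K : ℝ) + 244) * (4 * η) * (2 * 4 ^ K)
          = (8 * η * (240 * (K : ℝ) + 244) * 4 ^ K) * Real.exp (-(228 * K)) := by ring
        _ ≤ Real.exp (218 * K) * Real.exp (-(228 * K)) :=
            mul_le_mul_of_nonneg_right hηb (Real.exp_pos _).le
        _ = Real.exp (-(10 * K)) := by rw [← Real.exp_add]; ring_nf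
    refine h2.trans ?_
    have h4 : Real.exp (-(10 * K)) * 2⁻¹ ^ (2 * K + 1) ≤ M₀ := by
      rw [hM₀]; exact mul_le_mul_of_nonneg_left h2K (Real.exp_pos _).le
    have h5 : M₀ / (4 * η) = M₁ / 4 := by rw [hM₁]; field_simp
    rw [← h5]
    exact div_le_div_of_nonneg_right h4 (by positivity)
  /- ── the mean value ── -/
  set D₀ : ℝ := M₁ / (4 * r) with hD₀
  have hD₀pos : 0 < D₀ := by positivity
  have hD : D₀ ≤ ∫ t in Set.Ioc (NX : ℝ) x, r / t * ‖summatory cS t‖ := by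
    have : M₁ / (2 * r) - M₁ / (4 * r) = D₀ := by rw [hD₀]; field_simp; ring
    linarith [hG_lower, habel, hboundary]
  have hI := sq_div_le_integral_normSq cS hr hNX1 hNXx hD₀pos hD
  refine le_trans ?_ hI
  /- ── the final arithmetic: `(e^{-10}/η²) x^{-r/10}/r³ ≤ D₀²/(r² log(x/NX))` ── -/
  have hlogxNX : Real.log (x / NX) ≤ Lx := by
    rw [Real.log_div hx.ne' hNXpos.ne', hLx]
    linarith [Real.log_nonneg (show (1:ℝ) ≤ NX by exact_mod_cast hNX1)]
  have hlogxNXpos : 0 < Real.log (x / NX) := Real.log_pos (by rw [one_lt_div hNXpos]; exact hNXx)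
  -- lower bound for `(M₀/(4r))²` and `D₀² = (M₀/(4r))²/η²`
  have hD₀sq' : Real.exp (-(20 * K)) / (64 * 16 ^ K * r ^ 2) ≤ (M₀ / (4 * r)) ^ 2 := by
    rw [hM₀, div_pow, mul_pow]
    have h1 : (Real.exp (-(10 * K))) ^ 2 = Real.exp (-(20 * K)) := by rw [← Real.exp_nat_mul]; ring_nf
    rw [h1]
    have h2 : ((2 : ℝ)⁻¹ ^ (2 * K + 1)) ^ 2 ≤ ((2 : ℝ)⁻¹ ^ (k + 1)) ^ 2 :=
      pow_le_pow_left₀ (by positivity) h2K 2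
    have h3 : ((2 : ℝ)⁻¹ ^ (2 * K + 1)) ^ 2 = (4 * 16 ^ K)⁻¹ := by
      rw [← pow_mul, show (2 * K + 1) * 2 = 4 * K + 2 by ring, inv_pow, pow_add, pow_mul,
        show (2 : ℝ) ^ 4 = 16 by norm_num, show (2 : ℝ) ^ 2 = 4 by norm_num]
      ring
    rw [div_le_div_iff₀ (by positivity) (by positivity)]
    have h4 : (4 * r) ^ 2 = 16 * r ^ 2 := by ring
    rw [h4]
    have h5 : (4 * 16 ^ K : ℝ)⁻¹ ≤ ((2 : ℝ)⁻¹ ^ (k + 1)) ^ 2 := h3 ▸ h2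
    have hpos : 0 < Real.exp (-(20 * K)) := Real.exp_pos _
    calc Real.exp (-(20 * K)) * (16 * r ^ 2)
        = Real.exp (-(20 * K)) * (4 * 16 ^ K : ℝ)⁻¹ * (64 * 16 ^ K * r ^ 2) := by field_simp; ring
      _ ≤ Real.exp (-(20 * K)) * ((2 : ℝ)⁻¹ ^ (k + 1)) ^ 2 * (64 * 16 ^ K * r ^ 2) := by
          gcongr
  have hD₀sq : Real.exp (-(20 * K)) / (64 * 16 ^ K * r ^ 2) / η ^ 2 ≤ D₀ ^ 2 := by
    have : D₀ ^ 2 = (M₀ / (4 * r)) ^ 2 / η ^ 2 := by rw [hD₀, hM₁]; field_simp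
    rw [this]
    exact div_le_div_of_nonneg_right hD₀sq' (by positivity)
  -- compare
  have hxr : x ^ (-(r / 10)) ≤ Real.exp (-(24 * K)) := by
    rw [hxexp, ← Real.exp_mul]
    exact Real.exp_le_exp.2 (by nlinarith only [hK240])
  have hfin := final_ineq K
  have hr3 : 0 < r ^ 3 := by positivity
  have hchain : Real.exp (-10) * x ^ (-(r / 10)) / r ^ 3 ≤
      Real.exp (-(20 * K)) / (64 * 16 ^ K * r ^ 2) / (r ^ 2 * Real.log (x / NX)) := by
   calc Real.exp (-10) * x ^ (-(r / 10)) / r ^ 3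
      ≤ Real.exp (-10) * Real.exp (-(24 * K)) / r ^ 3 := by gcongr
    _ = Real.exp (-(20 * K)) / (Real.exp (4 * K + 10) * r ^ 3) := by
        rw [div_eq_div_iff hr3.ne' (by positivity), ← Real.exp_add, ← mul_assoc, ← Real.exp_add]
        congr 2; ring
    _ ≤ Real.exp (-(20 * K)) / (15360 * ((K : ℝ) + 1) * 16 ^ K * r ^ 3) := by
        refine div_le_div_of_nonneg_left (Real.exp_pos _).le (by positivity) ?_
        exact mul_le_mul_of_nonneg_right hfin hr3.le
    _ ≤ (Real.exp (-(20 * K)) / (64 * 16 ^ K * r ^ 2)) / (r ^ 2 * Real.log (x / NX)) := by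
        rw [div_div, div_le_div_iff_of_pos_left (Real.exp_pos _) (by positivity) (by positivity)]
        -- `64·16^K r² · r² log(x/NX) ≤ 64·16^K r⁴ Lx ≤ 64 · 16^K · r³ · 240 (K+1)`
        have h1 : r ^ 2 * Real.log (x / NX) ≤ r ^ 2 * Lx := mul_le_mul_of_nonneg_left hlogxNX (by positivity)
        have h2 : r ^ 2 * Lx ≤ r * (240 * ((K : ℝ) + 1)) := by
          have := mul_le_mul_of_nonneg_left hK240'.le hr.le
          nlinarith only [this]
        calc 64 * 16 ^ K * r ^ 2 * (r ^ 2 * Real.log (x / NX)) ≤ 64 * 16 ^ K * r ^ 2 * (r * (240 * ((K : ℝ) + 1))) := by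
              refine mul_le_mul_of_nonneg_left (h1.trans h2) (by positivity)
          _ = 15360 * ((K : ℝ) + 1) * 16 ^ K * r ^ 3 := by ring
  calc Real.exp (-10) / η ^ 2 * x ^ (-(r / 10)) / r ^ 3
      = (Real.exp (-10) * x ^ (-(r / 10)) / r ^ 3) / η ^ 2 := by ring
    _ ≤ (Real.exp (-(20 * K)) / (64 * 16 ^ K * r ^ 2) / (r ^ 2 * Real.log (x / NX))) / η ^ 2 :=
        div_le_div_of_nonneg_right hchain (by positivity)
    _ = (Real.exp (-(20 * K)) / (64 * 16 ^ K * r ^ 2) / η ^ 2) / (r ^ 2 * Real.log (x / NX)) := by ring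
    _ ≤ D₀ ^ 2 / (r ^ 2 * Real.log (x / NX)) :=
        div_le_div_of_nonneg_right hD₀sq (by positivity)

end Literature.NumberTheory.LFunctions.LogFreeDensity

end
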